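import Summits.NavierStokesRegularity.NavierStokesRegularity.Theorems.SymmetryModuliCountStretchingCertificateComparisonMaxPrinciple
import HarnessLib

/-!
# A weak maximum principle on the whole space with a NON-NEGATIVE diffusion coefficient
  (route `TypeICertificateLadder`, C32 of cell pub-ns-dss for Euler AND Navier–Stokes; helper of
  crux stmt-NavierStokesRegularity-2882)

The tree's `le_of_subsolution_linear_drift` (`SymmetryModuliCountStretchingCertificateComparisonMaxPrinciple.lean`,
Lieberman 1996, Ch. II, with the quadratic barrier `M + ε e^{β(t−T₁)}(1 + |x|²)`) is stated for the
inequality `Pₜ ≤ ΔP + K(1 + |x|)‖∇P‖`. Its barrier argument uses the Laplacian only through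
`ΔP ≤ Δ(barrier) = 6c` at an interior maximum, so it goes through verbatim for
`Pₜ ≤ νΔP + K(1 + |x|)‖∇P‖` with ANY `ν ≥ 0` (`β = 6ν + 3K + 1`) — in particular for the pure
transport–reaction inequalities of the Euler equations (`ν = 0`), where no diffusion is available:

* `le_of_subsolution_linear_drift_of_nonneg` — `P` jointly continuous on `[T₁, T₂] × ℝ³`, `C²`
  slices, a time derivative `Pₜ` on `(T₁, T₂]`, bounded above, `Pₜ ≤ νΔP + K(1 + ‖x‖)‖∇P‖`
  (`ν, K ≥ 0`), `P(T₁, ·) ≤ M` ⇒ `P ≤ M`.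

(The `ν > 0` case also follows from the tree's statement by time rescaling,
`le_of_subsolution_linear_drift_viscosity`; the point of this file is `ν = 0`.) The proof is the
tree's, with the diffusion coefficient carried along.
-/

noncomputable section

set_option linter.dupNamespace false

open Set Function Filter Metric
open scoped RealInnerProductSpace Laplacian ContDiff Topology

namespace Summit.NavierStokesRegularity.NavierStokesRegularity.Theorems

open Literature.Analysis Literature.Analysis.FluidPDE

/-- **Weak maximum principle on `[T₁, T₂] × ℝ³` for bounded subsolutions with linearly growing drift
and a non-negative diffusion coefficient.** Let `P` be jointly continuous on `[T₁, T₂] × ℝ³`, with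
`C²` slices `P t` and a time derivative `Pₜ t x` for `t ∈ (T₁, T₂]`, bounded above (`P ≤ B`), and
satisfying at every point of `(T₁, T₂] × ℝ³` the inequality `Pₜ ≤ νΔP + K (1 + ‖x‖) ‖∇P‖`
(`ν ≥ 0`, `K ≥ 0`; `ν = 0` allowed). If `P(T₁, ·) ≤ M` then `P ≤ M` on `[T₁, T₂] × ℝ³`. Proof: the
tree's barrier argument (`weak_max_principle` on the balls `‖x‖ ≤ R` applied to
`w = P − M − ε e^{β(t−T₁)}(1 + ‖x‖²)`, `β = 6ν + 3K + 1`): at a critical point `∇P = 2c⟪x, ·⟫`,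
`ΔP ≤ 6c` (`c = ε e^{β(t−T₁)}`), so `Pₜ ≤ 6νc + 3Kc(1 + ‖x‖²) < ∂ₜ` of the barrier; then `ε → 0`.
[cite: Lieberman1996, Ch. II Lemma 2.1 and Lemma 2.3; Thm. 2.4 (unbounded domains)] -/
theorem le_of_subsolution_linear_drift_of_nonneg {ν T₁ T₂ M B K : ℝ} (hν : 0 ≤ ν) (hK : 0 ≤ K)
    {P Pₜ : ℝ → (EuclideanSpace ℝ (Fin 3)) → ℝ}
    (hc : ContinuousOn (uncurry P) (Icc T₁ T₂ ×ˢ univ))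
    (h2 : ∀ t ∈ Ioc T₁ T₂, ContDiff ℝ 2 (P t))
    (ht : ∀ t ∈ Ioc T₁ T₂, ∀ x, HasDerivAt (fun s => P s x) (Pₜ t x) t)
    (hsub : ∀ t ∈ Ioc T₁ T₂, ∀ x,
      Pₜ t x ≤ ν * (Δ (P t)) x + K * (1 + ‖x‖) * ‖fderiv ℝ (P t) x‖)
    (hB : ∀ t ∈ Icc T₁ T₂, ∀ x, P t x ≤ B) (hM : ∀ x, P T₁ x ≤ M) :
    ∀ t ∈ Icc T₁ T₂, ∀ x, P t x ≤ M := by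
  -- constants of the barrier
  set β : ℝ := 6 * ν + 3 * K + 1 with hβ
  have hβ0 : 0 ≤ β := by rw [hβ]; positivity
  -- the claim for every `ε > 0`, on every large ball
  suffices key : ∀ ε : ℝ, 0 < ε → ∀ R : ℝ, (B - M) / ε ≤ R → 0 ≤ R →
      ∀ t ∈ Icc T₁ T₂, ∀ x ∈ closedBall (0 : (EuclideanSpace ℝ (Fin 3))) R,
        P t x - (M + ε * Real.exp (β * (t - T₁)) * (1 + ‖x‖ ^ 2)) ≤ 0 by
    intro t htI x
    refine le_of_forall_pos_le_add fun η hη => ?_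
    set C : ℝ := Real.exp (β * (t - T₁)) * (1 + ‖x‖ ^ 2) with hC
    have hCpos : 0 < C := by positivity
    have h := key (η / C) (div_pos hη hCpos) (max (max ((B - M) / (η / C)) ‖x‖) 0)
      ((le_max_left _ _).trans (le_max_left _ _)) (le_max_right _ _) t htI x
      (mem_closedBall_zero_iff.2 ((le_max_right _ _).trans (le_max_left _ _)))
    have e : η / C * Real.exp (β * (t - T₁)) * (1 + ‖x‖ ^ 2) = η := by
      rw [hC]; field_simp
    rw [e] at h
    linarith
  intro ε hε R hR hR0
  -- the comparison function and its time derivative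
  set w : ℝ → (EuclideanSpace ℝ (Fin 3)) → ℝ := fun t x =>
    P t x - (M + ε * Real.exp (β * (t - T₁)) * (1 + ‖x‖ ^ 2)) with hw
  set wₜ : ℝ → (EuclideanSpace ℝ (Fin 3)) → ℝ := fun t x =>
    Pₜ t x - β * (ε * Real.exp (β * (t - T₁)) * (1 + ‖x‖ ^ 2)) with hwₜ
  set Kc : Set (EuclideanSpace ℝ (Fin 3)) := closedBall 0 R with hKc
  set U : Set (EuclideanSpace ℝ (Fin 3)) := ball 0 R with hU
  have hKcc : IsCompact Kc := isCompact_closedBall _ _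
  have hUo : IsOpen U := isOpen_ball
  have hUK : U ⊆ Kc := ball_subset_closedBall
  -- (a) joint continuity
  have hcw : ContinuousOn (uncurry w) (Icc T₁ T₂ ×ˢ Kc) := by
    have h1 : ContinuousOn (uncurry P) (Icc T₁ T₂ ×ˢ Kc) := hc.mono (prod_mono Subset.rfl (subset_univ _))
    have h2 : Continuous fun p : ℝ × (EuclideanSpace ℝ (Fin 3)) =>
        M + ε * Real.exp (β * (p.1 - T₁)) * (1 + ‖p.2‖ ^ 2) := by fun_prop
    exact (h1.sub h2.continuousOn).congr fun p _ => rfl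
  -- (b) smooth slices
  have h2w : ∀ t ∈ Ioc T₁ T₂, ContDiff ℝ 2 (w t) := fun t htI =>
    (h2 t htI).sub (contDiff_barrier M (ε * Real.exp (β * (t - T₁))))
  -- (c) the (left) time derivative
  have htw : ∀ t ∈ Ioc T₁ T₂, ∀ x ∈ U, HasDerivWithinAt (fun s => w s x) (wₜ t x) (Icc T₁ t) t := by
    intro t htI x _
    have hP := ht t htI x
    have hexp : HasDerivAt (fun s => M + ε * Real.exp (β * (s - T₁)) * (1 + ‖x‖ ^ 2))
        (ε * (Real.exp (β * (t - T₁)) * β) * (1 + ‖x‖ ^ 2)) t := by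
      have h1 : HasDerivAt (fun s => Real.exp (β * (s - T₁))) (Real.exp (β * (t - T₁)) * β) t := by
        have := (((hasDerivAt_id t).sub_const T₁).const_mul β).exp
        simpa using this
      exact ((h1.const_mul ε).mul_const (1 + ‖x‖ ^ 2)).const_add M
    have h := (hP.sub hexp).hasDerivWithinAt (s := Icc T₁ t)
    simp only [hw, hwₜ]
    exact h.congr_deriv (by ring)
  -- (d) the sub-solution implication
  have hsubw : ∀ t ∈ Ioc T₁ T₂, ∀ x ∈ U, fderiv ℝ (w t) x = 0 → (Δ (w t)) x ≤ 0 → wₜ t x ≤ 0 := by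
    intro t htI x _ hgrad hlap
    set c : ℝ := ε * Real.exp (β * (t - T₁)) with hcdef
    have hc0 : 0 < c := by positivity
    -- gradient at the critical point
    have hPd : DifferentiableAt ℝ (P t) x := ((h2 t htI).differentiable two_ne_zero) x
    have hBd := hasFDerivAt_barrier M c x
    have hwderiv : HasFDerivAt (w t) (fderiv ℝ (P t) x -
        c • ((2 : ℕ) • (innerSL ℝ x : (EuclideanSpace ℝ (Fin 3)) →L[ℝ] ℝ))) x := by
      have h := hPd.hasFDerivAt.sub hBd
      simp only [hw, hcdef]
      exact h
    have hDeq : fderiv ℝ (P t) x = c • ((2 : ℕ) • (innerSL ℝ x : (EuclideanSpace ℝ (Fin 3)) →L[ℝ] ℝ)) := by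
      have := hwderiv.fderiv
      rw [hgrad] at this
      exact (sub_eq_zero.1 this.symm)
    have hnormD : ‖fderiv ℝ (P t) x‖ ≤ 2 * c * ‖x‖ := by
      rw [hDeq]
      have := norm_barrier_fderiv_le c x
      rwa [abs_of_pos hc0] at this
    -- Laplacian at the critical point
    have hΔeq : (Δ (w t)) x = (Δ (P t)) x - 6 * c := by
      have h1 : ContDiffAt ℝ 2 (P t) x := (h2 t htI).contDiffAt
      have h3 : ContDiffAt ℝ 2 (fun y : (EuclideanSpace ℝ (Fin 3)) => (M + c * (1 + ‖y‖ ^ 2) : ℝ)) x :=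
        (contDiff_barrier M c).contDiffAt
      have h4 := h1.laplacian_sub h3
      have hfun : w t = (P t) - fun y : (EuclideanSpace ℝ (Fin 3)) => (M + c * (1 + ‖y‖ ^ 2) : ℝ) := by
        funext y
        simp only [hw, hcdef, Pi.sub_apply]
      rw [hfun, h4, laplacian_barrier]
    have hΔ : (Δ (P t)) x ≤ 6 * c := by rw [hΔeq] at hlap; linarith
    -- the one-point inequality
    have hPt := hsub t htI x
    have hdrift : K * (1 + ‖x‖) * ‖fderiv ℝ (P t) x‖ ≤ K * (1 + ‖x‖) * (2 * c * ‖x‖) :=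
      mul_le_mul_of_nonneg_left hnormD (by positivity)
    have hx2 : K * (1 + ‖x‖) * (2 * c * ‖x‖) ≤ 3 * K * (c * (1 + ‖x‖ ^ 2)) := by
      have hx0 := norm_nonneg x
      have e : 3 * K * (c * (1 + ‖x‖ ^ 2)) - K * (1 + ‖x‖) * (2 * c * ‖x‖) =
          K * c * ((1 - ‖x‖) ^ 2 + 2) := by ring
      have : 0 ≤ K * c * ((1 - ‖x‖) ^ 2 + 2) := by positivity
      linarith
    have hνΔ : ν * (Δ (P t)) x ≤ ν * (6 * c) := mul_le_mul_of_nonneg_left hΔ hν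
    have h6 : ν * (6 * c) ≤ 6 * ν * (c * (1 + ‖x‖ ^ 2)) := by
      have : 0 ≤ ν * c * ‖x‖ ^ 2 := by positivity
      nlinarith
    have hpos : 0 ≤ c * (1 + ‖x‖ ^ 2) := by positivity
    have e3 : wₜ t x = Pₜ t x - β * (c * (1 + ‖x‖ ^ 2)) := by
      simp only [hwₜ, hcdef]
    rw [e3, hβ]
    nlinarith [hPt, hdrift, hx2, hνΔ, h6, hc0, hpos, sq_nonneg ‖x‖]
  -- (e) the parabolic boundary: `t = T₁`
  have hbot : ∀ x ∈ Kc, w T₁ x ≤ 0 := by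
    intro x _
    simp only [hw, sub_self, mul_zero, Real.exp_zero, mul_one]
    have h1 := hM x
    have h3 : 0 ≤ ε * (1 + ‖x‖ ^ 2) := by positivity
    linarith
  -- (f) the parabolic boundary: the sphere `‖x‖ = R`
  have hlat : ∀ t ∈ Icc T₁ T₂, ∀ x ∈ Kc \ U, w t x ≤ 0 := by
    intro t htI x hx
    have hexp1 : 1 ≤ Real.exp (β * (t - T₁)) :=
      Real.one_le_exp (mul_nonneg hβ0 (by linarith [htI.1]))
    have hH : ε * (1 + ‖x‖ ^ 2) ≤ ε * Real.exp (β * (t - T₁)) * (1 + ‖x‖ ^ 2) := by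
      have : ε * (1 + ‖x‖ ^ 2) * 1 ≤ ε * (1 + ‖x‖ ^ 2) * Real.exp (β * (t - T₁)) :=
        mul_le_mul_of_nonneg_left hexp1 (by positivity)
      linarith
    have hxK : ‖x‖ ≤ R := mem_closedBall_zero_iff.1 hx.1
    have hxR : ‖x‖ = R := by
      have hnot : x ∉ ball (0 : (EuclideanSpace ℝ (Fin 3))) R := hx.2
      have : R ≤ ‖x‖ := by simpa using hnot
      exact le_antisymm hxK this
    have hPB := hB t htI x
    have h2' : B - M ≤ ε * (1 + ‖x‖ ^ 2) := by
      rw [hxR]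
      have h1 : B - M ≤ R * ε := (div_le_iff₀ hε).1 hR
      nlinarith [sq_nonneg (R - 1), hε]
    simp only [hw]
    linarith
  exact weak_max_principle hKcc hUo hUK hcw h2w htw hsubw hbot hlat

end Summit.NavierStokesRegularity.NavierStokesRegularity.Theorems

end
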